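import Literature.NumberTheory.EllipticCurves.OpenImageMazurAssemblyProofs
import Literature.NumberTheory.GaloisRepresentations.DirichletCharacterOfGaloisCharacter
import HarnessLib

/-!
# The isogeny character at a Frobenius `φ_ℓ`, `ℓ ≡ 1 (mod M)`: `r(φ_ℓ)² = 1`
# (a congruence sieve for rational isogenies through Kronecker–Weber)

Topic `Literature/NumberTheory/EllipticCurves`; a theorems-only companion (no definition, no named
fact) of `OpenImageMazurProofs` / `OpenImageMazurFrobeniusProofs` (B. Mazur, *Rational isogenies of
prime degree*, Invent. Math. 44 (1978), §5 — the isogeny character `r` of a `Γ_ℚ`-stable line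
`⟨P⟩ ⊂ E[p]` — and §6 Prop. 6.3 (1): `r(φ_ℓ)² − a_ℓ r(φ_ℓ) + ℓ = 0` at a good prime `ℓ`).

Mazur's Prop. 6.3 (1) gives, at ONE good prime `ℓ`, that `X² − a_ℓ X + ℓ` has a root mod `p`; the
tree turns a root-free `ℓ` into irreducibility of `E[p]` (`Frobenius witness`,
`Summit.…IntModel.hasIrreducibleModPGaloisRep_of_intModel_of_noroot`).  There are irreducible
mod `p` images in which EVERY element has an `𝔽_p`-rational eigenvalue (e.g. the index-`2` subgroup
`{diag(x,y) : xy ∈ 𝔽₇ˣ²} ∪ {antidiag(a,b) : ab ∈ 𝔽₇ˣ²}` of the normaliser of the split Cartan at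
`p = 7`, realised by `j = 3³·5·7⁵/2⁷`, conductor `2450`), so that no single Frobenius can witness
irreducibility.  This file proves the classical refinement that pins `r(φ_ℓ)` down at primes `ℓ`
in a congruence class: the values of `r` are controlled by the CONDUCTOR of `r²` as a Dirichlet
character.

* `int_dvd_pow_sub_one_of_forall_prime_dvd` (private helper) — lifting the exponent: if every
  prime factor of `N` divides `M` and `M ∣ x − 1`, then `N ∣ x^N − 1` (`q ∣ x − 1 ⇒
  q^{k+1} ∣ x^{q^k} − 1`, Mathlib `dvd_sub_pow_of_dvd_sub`, and coprime factors multiply).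
* `isogenyCharacter_sq_eq_one_of_isArithFrobAt_of_modEq_one` — **the sieve.**  Let `E/ℚ` be an
  elliptic curve, `p` an odd prime, `r : Γ_ℚ → 𝔽_pˣ` the character of a `Γ_ℚ`-stable line in `E[p]`,
  and `M` a natural number with `p ∣ M`, `gcd(M, (p−1)/2) = 1`, such that at every prime `q ∤ M` the
  curve has good reduction or potentially multiplicative reduction (`|j|_q > 1`).  Then for every
  prime `ℓ ≡ 1 (mod M)` and every arithmetic Frobenius `φ` at a prime of `ℤ̄` above `ℓ`:
  **`r(φ)² = 1`**.  Proof: `u = r²` is trivial on the inertia groups at every `q ∤ M` (good `q ≠ p`: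
  Silverman VII.4.1, tree `Mazur1978.isogenyCharacter_eq_one_of_mem_inertia`; potentially
  multiplicative `q`: `r(I_q)² = 1`, tree
  `Mazur1978.isogenyCharacter_sq_eq_one_of_one_lt_valuation_j`); for each character
  `e : 𝔽_pˣ → ℂˣ` the finite-order character `e ∘ u` of `Γ_ℚ` is, by the Kronecker–Weber theorem
  PROVED in the tree (`exists_isPrimitive_dirichletCharacter_eq_dirichletGaloisCharacter`), a
  primitive Dirichlet character `χ` whose conductor `N` is divisible only by primes dividing `M`
  (`not_dvd_level_of_isPrimitive_of_forall_mem_inertia`); hence `N ∣ ℓ^N − 1`, so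
  `χ(ℓ)^N = 1`, while `χ(ℓ)^{(p−1)/2} = e(r(φ)^{p−1}) = 1`
  (`FramedRep.coe_dirichletGaloisCharacter_of_isArithFrobAt`); `gcd(N, (p−1)/2) = 1` gives
  `χ(ℓ) = 1`, i.e. `e(u(φ)) = 1` for every `e`, so `u(φ) = 1` (characters of a finite abelian group
  separate points, Mathlib `CommGroup.forall_apply_eq_apply_iff`).
  With Prop. 6.3 (1) this says: `1 − a_ℓ + ℓ ≡ 0` or `1 + a_ℓ + ℓ ≡ 0 (mod p)`, i.e.
  `p ∣ #Ẽ(𝔽_ℓ)` or `#Ẽ(𝔽_ℓ) ≡ 2(ℓ + 1) (mod p)` — a test that an irreducible `E[p]` fails at a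
  positive density of `ℓ ≡ 1 (mod M)` (consumer: the Summit-side integer-model certificate
  `IntModel.hasIrreducibleModPGaloisRep_of_intModel_of_unitRoot`).

This is the standard "isogeny character as a Dirichlet character of bounded conductor" argument
(Mazur 1978 §5, p. 148: `r : Gal(K̄/K)^{ab} → (ℤ/N)^*`, Lemma 5.2 / Prop. 5.1 on its ramification;
Serre 1972 §5.6 for the practical sieve against `a_ℓ`), assembled from tree theorems; nothing here
is specific to `p = 7`.  Not treated (deliberately): additive potentially good primes `q ∤ M` (they
must be put into `M`; at `q = 2` a finer analysis of `r(I_2)` would be needed).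

## References

* [Mazur1978] B. Mazur, *Rational isogenies of prime degree*, Invent. Math. 44 (1978) 129–162:
  §5 (p. 148, the isogeny character; Lemma 5.2, Prop. 5.1), §6 Prop. 6.3 (1) (p. 153).
* [Serre1972] J.-P. Serre, *Propriétés galoisiennes des points d'ordre fini des courbes
  elliptiques*, Invent. Math. 15 (1972), §5.6 (checking irreducibility from `a_ℓ`).
* [Washington1997] L. C. Washington, *Introduction to Cyclotomic Fields*, GTM 83, Ch. 3
  (pp. 19–21: Dirichlet characters, conductor and ramification).
* [SilvermanAEC2009] J. H. Silverman, *The Arithmetic of Elliptic Curves*, 2nd ed., VII.4.1(a),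
  VII.5.1(b).
-/

noncomputable section

open scoped Classical
open NumberField IsDedekindDomain IsDedekindDomain.HeightOneSpectrum Field WeierstrassCurve
  Literature.NumberTheory.GaloisRepresentations

namespace Literature.NumberTheory.EllipticCurves.Mazur1978

/-! ### Lifting the exponent: `N ∣ x^N − 1` when the primes of `N` divide `M ∣ x − 1` -/

/-- **Lifting the exponent.** If every prime factor of `N` divides `M` and `M ∣ x − 1` (integers),
then `N ∣ x ^ N − 1`: for a prime power `q^k ∣∣ N`, `q ∣ x − 1` gives `q^{k+1} ∣ x^{q^k} − 1`
(Mathlib `dvd_sub_pow_of_dvd_sub`) and `x^{q^k} − 1 ∣ x^N − 1`; coprime parts multiply.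
Private arithmetic helper of the sieve below. [folklore] -/
private theorem int_dvd_pow_sub_one_of_forall_prime_dvd {N M : ℕ} {x : ℤ}
    (hN : ∀ q : ℕ, q.Prime → q ∣ N → q ∣ M) (hM : (M : ℤ) ∣ x - 1) :
    (N : ℤ) ∣ x ^ N - 1 := by
  induction N using Nat.recOnPrimeCoprime with
  | zero => simp
  | prime_pow q k hq =>
    rcases Nat.eq_zero_or_pos k with rfl | hk
    · simp
    · have hqM : q ∣ M := hN q hq (dvd_pow_self q hk.ne')
      have hqx : (q : ℤ) ∣ x - 1 := (Int.natCast_dvd_natCast.mpr hqM).trans hM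
      have h := dvd_sub_pow_of_dvd_sub hqx k
      rw [one_pow] at h
      push_cast
      exact (pow_dvd_pow (q : ℤ) k.le_succ).trans h
  | coprime a b _ _ hab iha ihb =>
    have ha' : (a : ℤ) ∣ x ^ a - 1 := iha fun q hq hqa => hN q hq (hqa.mul_right b)
    have hb' : (b : ℤ) ∣ x ^ b - 1 := ihb fun q hq hqb => hN q hq (hqb.mul_left a)
    push_cast
    refine (Nat.isCoprime_iff_coprime.mpr hab).mul_dvd ?_ ?_
    · rw [pow_mul]
      exact ha'.trans (by simpa only [one_pow] using sub_dvd_pow_sub_pow (x ^ a) 1 b)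
    · rw [mul_comm a b, pow_mul]
      exact hb'.trans (by simpa only [one_pow] using sub_dvd_pow_sub_pow (x ^ b) 1 a)

/-! ### The sieve: `r(φ_ℓ)² = 1` for `ℓ ≡ 1 (mod M)` -/

/-- **The square of a rational isogeny character is trivial at the Frobenius of every prime
`ℓ ≡ 1 (mod M)`**, when `p ∣ M`, `gcd(M, (p − 1)/2) = 1` and `E` has good or potentially
multiplicative reduction at every prime `q ∤ M`.  For `E/ℚ` elliptic, `p` an odd prime, `⟨P⟩ ⊂ E[p]`
a `Γ_ℚ`-stable line with character `r` (`σ P = r(σ) P`), a prime `ℓ ≡ 1 (mod M)`, a prime `𝔏` of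
`ℤ̄` above `ℓ` and an arithmetic Frobenius `φ` at `𝔏`: `r(φ)² = 1`.  (So `r(φ) = ±1`, and Mazur's
Prop. 6.3 (1) forces `p ∣ #Ẽ(𝔽_ℓ)` or `#Ẽ(𝔽_ℓ) ≡ 2(ℓ + 1) (mod p)`.)  Proof in the module docstring:
`r²` is unramified outside the primes of `M`; read through every `e : 𝔽_pˣ → ℂˣ` as a primitive
Dirichlet character (Kronecker–Weber) its conductor `N` has `N ∣ ℓ^N − 1` and is prime to
`(p − 1)/2`, so its value at `ℓ` is `1`; characters separate points.
[cite: Mazur1978, §5 (p. 148) and §6 Prop. 6.3 (1) (p. 153)] -/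
theorem isogenyCharacter_sq_eq_one_of_isArithFrobAt_of_modEq_one (W : WeierstrassCurve ℚ)
    [W.IsElliptic] (p : ℕ) [Fact p.Prime] (hp2 : p ≠ 2) {P : geomTorsion W p} (hP0 : P ≠ 0)
    {r : absoluteGaloisGroup ℚ →* (ZMod p)ˣ}
    (hr : ∀ σ : absoluteGaloisGroup ℚ, σ • P = ((r σ : (ZMod p)ˣ) : ZMod p).val • P)
    {M : ℕ} (hpM : p ∣ M) (hcop : M.Coprime ((p - 1) / 2))
    (hS : ∀ q : ℕ, q.Prime → ¬ q ∣ M → ∀ v : HeightOneSpectrum (𝓞 ℚ), (q : 𝓞 ℚ) ∈ v.asIdeal →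
      W.HasGoodReductionAt v ∨ 1 < v.valuation ℚ W.j)
    {ℓ : ℕ} (hℓ : ℓ.Prime) (hMℓ : ℓ ≡ 1 [MOD M])
    {w : HeightOneSpectrum (𝓞 ℚ)} (hw : (ℓ : 𝓞 ℚ) ∈ w.asIdeal)
    {𝔏 : Ideal (absIntegers (𝓞 ℚ) ℚ)} (h𝔏 : 𝔏 ∈ w.primesAbove)
    {φ : absoluteGaloisGroup ℚ} (hφ : IsArithFrobAt (𝓞 ℚ) φ 𝔏) :
    r φ ^ 2 = 1 := by
  have hp : p.Prime := Fact.out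
  have hMℓ' : (M : ℤ) ∣ (ℓ : ℤ) - 1 := by
    have h := (Nat.modEq_iff_dvd.mp hMℓ.symm)
    push_cast at h
    exact h
  -- Step 1: `r²` is trivial on every inertia group at a prime `q ∤ M`
  have hinert : ∀ q : ℕ, q.Prime → ¬ q ∣ M → ∀ v : HeightOneSpectrum (𝓞 ℚ), (q : 𝓞 ℚ) ∈ v.asIdeal →
      ∀ 𝔓 ∈ v.primesAbove, ∀ τ ∈ 𝔓.inertia (absoluteGaloisGroup ℚ), r τ ^ 2 = 1 := by
    intro q hq hqM v hv 𝔓 h𝔓 τ hτ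
    have hqp : q ≠ p := fun h => hqM (h ▸ hpM)
    have hpv : (p : 𝓞 ℚ) ∉ v.asIdeal := natCast_not_mem_of_natCast_mem hq hp hqp hv
    rcases hS q hq hqM v hv with hgood | hj
    · rw [isogenyCharacter_eq_one_of_mem_inertia W p hP0 hr hgood hpv h𝔓 hτ, one_pow]
    · exact isogenyCharacter_sq_eq_one_of_one_lt_valuation_j W p hP0 hr hpv hj h𝔓 hτ
  -- `ℓ ∤ M` (as `ℓ ≡ 1 (mod M)` and `ℓ > 1`)
  have hℓM : ¬ ℓ ∣ M := by
    intro h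
    have h1 : (ℓ : ℤ) ∣ (ℓ : ℤ) - 1 := (Int.natCast_dvd_natCast.mpr h).trans hMℓ'
    have h2 : (ℓ : ℤ) ∣ 1 := by
      have h3 := dvd_sub (dvd_refl (ℓ : ℤ)) h1
      rwa [sub_sub_cancel] at h3
    have h4 : (ℓ : ℤ) = 1 := Int.eq_one_of_dvd_one (by positivity) h2
    exact hℓ.one_lt.ne' (by exact_mod_cast h4)
  have hwℓ : ((Rat.HeightOneSpectrum.primesEquiv w : Nat.Primes) : ℕ) = ℓ :=
    primesEquiv_eq_of_natCast_mem hℓ hw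
  -- Step 2: every character `e` of `𝔽_pˣ` kills `r(φ)²`
  have key : ∀ e : (ZMod p)ˣ →* ℂˣ, e (r φ ^ 2) = e 1 := by
    intro e
    rw [map_one]
    set ψ : absoluteGaloisGroup ℚ →* ℂˣ := e.comp ((powMonoidHom 2).comp r) with hψdef
    have hψapply : ∀ σ, ψ σ = e (r σ ^ 2) := fun σ => rfl
    have hker :
        IsOpen ((ψ.ker : Subgroup (absoluteGaloisGroup ℚ)) : Set (absoluteGaloisGroup ℚ)) := by
      refine Subgroup.isOpen_mono (H₁ := r.ker) ?_ (isOpen_ker_of_smul_eq W p hP0 hr)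
      intro σ hσ
      rw [MonoidHom.mem_ker] at hσ ⊢
      rw [hψapply, hσ, one_pow, map_one]
    obtain ⟨N, hN, χ, hχ, hψχ⟩ :=
      exists_isPrimitive_dirichletCharacter_eq_dirichletGaloisCharacter ψ hker
    -- every prime factor of the conductor `N` divides `M`
    have hNM : ∀ q : ℕ, q.Prime → q ∣ N → q ∣ M := by
      intro q hq hqN
      by_contra hqM
      haveI := Fact.mk hq
      set v : HeightOneSpectrum (𝓞 ℚ) :=
        (Rat.HeightOneSpectrum.primesEquiv (R := 𝓞 ℚ)).symm ⟨q, hq⟩ with hvdef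
      have hgen : Rat.HeightOneSpectrum.natGenerator v = q := by
        change ((Rat.HeightOneSpectrum.primesEquiv v : Nat.Primes) : ℕ) = q
        rw [hvdef, Equiv.apply_symm_apply]
      have hv : (q : 𝓞 ℚ) ∈ v.asIdeal := by
        have h := natCast_natGenerator_mem_asIdeal v
        rwa [hgen] at h
      obtain ⟨𝔓, h𝔓⟩ := v.primesAbove_nonempty
      refine not_dvd_level_of_isPrimitive_of_forall_mem_inertia hχ hq hv h𝔓 ?_ hqN
      intro τ hτ
      rw [← hψχ τ, hψapply, hinert q hq hqM v hv 𝔓 h𝔓 τ hτ, map_one, Units.val_one]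
    have hℓN : ¬ ℓ ∣ N := fun h => hℓM (hNM ℓ hℓ h)
    -- the value at `φ`: `ψ φ = χ ℓ`
    have hval : (ψ φ : ℂ) = χ (ℓ : ZMod N) := by
      have h := FramedRep.coe_dirichletGaloisCharacter_of_isArithFrobAt χ h𝔏
        (by rw [hwℓ]; exact hℓN) hφ
      rw [hwℓ] at h
      rw [hψχ φ, h]
    -- `χ(ℓ)^N = 1` by lifting the exponent
    have hpowN : χ (ℓ : ZMod N) ^ N = 1 := by
      have hdvd : (N : ℤ) ∣ (ℓ : ℤ) ^ N - 1 := int_dvd_pow_sub_one_of_forall_prime_dvd hNM hMℓ'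
      have hℓpow : (ℓ : ZMod N) ^ N = 1 := by
        have h0 : (((ℓ : ℤ) ^ N - 1 : ℤ) : ZMod N) = 0 :=
          (ZMod.intCast_zmod_eq_zero_iff_dvd _ N).mpr hdvd
        push_cast at h0
        exact sub_eq_zero.mp h0
      rw [← map_pow, hℓpow, map_one]
    -- `χ(ℓ)^{(p-1)/2} = 1` as `r(φ)^{p-1} = 1`
    have hpowp : χ (ℓ : ZMod N) ^ ((p - 1) / 2) = 1 := by
      rw [← hval, hψapply, ← Units.val_pow_eq_pow_val, ← map_pow, ← pow_mul,
        Nat.two_mul_div_two_of_even (hp.even_sub_one hp2), ← ZMod.card_units p, pow_card_eq_one,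
        map_one, Units.val_one]
    -- `gcd(N, (p-1)/2) = 1`, so `χ(ℓ) = 1`
    have hcopN : N.Coprime ((p - 1) / 2) := Nat.coprime_of_dvd fun k hk hkN hkp =>
      hk.one_lt.ne' (((hcop.coprime_dvd_left (hNM k hk hkN))).eq_one_of_dvd hkp)
    have h1 : χ (ℓ : ZMod N) = 1 := by
      have h := (pow_gcd_eq_one (a := χ (ℓ : ZMod N)) (m := N) (n := (p - 1) / 2)).mpr
        ⟨hpowN, hpowp⟩
      rwa [Nat.Coprime.gcd_eq_one hcopN, pow_one] at h
    -- conclude `e (r φ ^ 2) = 1`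
    apply Units.ext
    rw [← hψapply, Units.val_one, hval, h1]
  -- Step 3: characters of the finite abelian group `𝔽_pˣ` separate points
  haveI : NeZero ((Monoid.exponent (ZMod p)ˣ : ℕ) : ℂ) :=
    ⟨Nat.cast_ne_zero.mpr
      (Monoid.exponent_ne_zero.mpr (Monoid.ExponentExists.of_finite (G := (ZMod p)ˣ)))⟩
  haveI : HasEnoughRootsOfUnity ℂ (Monoid.exponent (ZMod p)ˣ) := inferInstance
  exact (CommGroup.forall_apply_eq_apply_iff (ZMod p)ˣ).mp key

end Literature.NumberTheory.EllipticCurves.Mazur1978
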